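import Mathlib
import HarnessLib
import Summits.ValiantsHypothesis.ValiantsHypothesis.Theses.MonotoneRestoration
import Literature.Computability.AlgebraicComplexity.ArithCircuit
import Literature.Computability.AlgebraicComplexity.ArithCircuitProofs
import Literature.Computability.AlgebraicComplexity.MonotoneStructure
import Literature.Computability.AlgebraicComplexity.PermanentIrreducible
import Literature.ModelTheory.FiniteModelTheory.CkEquiv
import Summits.ValiantsHypothesis.ValiantsHypothesis.Theorems.MonotoneRestorationMonotoneRestorationQPCosetCount
import Summits.ValiantsHypothesis.ValiantsHypothesis.Theorems.MonotoneRestorationMonotoneRestorationQPSymmetricLB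
import Summits.ValiantsHypothesis.ValiantsHypothesis.Theorems.MonotoneRestorationMonotoneRestorationQPSupportSymmetrisation
import Summits.ValiantsHypothesis.ValiantsHypothesis.Theorems.MonotoneRestorationMonotoneRestorationQPSparseRegime
import Summits.ValiantsHypothesis.ValiantsHypothesis.Theorems.MonotoneRestorationMonotoneRestorationQPBeta
import Literature.Computability.AlgebraicComplexity.SymmetricArithCircuit
import Literature.Computability.AlgebraicComplexity.DawarWilsenach2025Proofs
import Literature.GroupTheory.PermutationGroups.SmallIndexSubgroups
import Summits.ValiantsHypothesis.ValiantsHypothesis.Theorems.MonotoneRestorationQP.Negative.LoadBearing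
import Summits.ValiantsHypothesis.ValiantsHypothesis.Theorems.MonotoneRestorationMonotoneRestorationQPPermSupportCount

/-! TTRL-lite variant V19262 of stmt-ValiantsHypothesis-15886

Closing step `provided_le_length`: a polynomial occurring in the value list of a fan-in-two gate
list `gs` has complexity at most `gs.length`. If `f = (gateValues gs)[i]`, the circuit `⟨gs, .gate i⟩`
is fan-in two, has size `gs.length`, and computes `f`; conclude with
`ArithCircuit.complexity_le_size` (Bürgisser 2000, Def. 2.1).
-/

-- `Summit.ValiantsHypothesis.ValiantsHypothesis.…` is the tree's mandated single-conjunct layout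
-- (Sub = Summit), so the duplicated namespace component is intended.
set_option linter.dupNamespace false

namespace Summit.ValiantsHypothesis.ValiantsHypothesis.Theorems

open Summit.ValiantsHypothesis.ValiantsHypothesis.Theses.MonotoneRestoration
open Literature.Computability.AlgebraicComplexity

/-- TTRL-lite variant V19262 of `stub_esymmRowSums_complexity` (stmt-ValiantsHypothesis-15886):
every value of a fan-in-two gate list `gs` has complexity `≤ gs.length` — the circuit with gate
list `gs` and output operand `gate i` computes the `i`-th gate value and has size `gs.length`
(Bürgisser 2000, Def. 2.1; tree: `ArithCircuit.complexity_le_size`). -/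
theorem stub_esymmRowSums_complexity_var19262 :
    ∀ (σ : Type) (f : MvPolynomial σ NNReal) (gs : List (ArithCircuit.Gate NNReal σ)),
      (∀ g ∈ gs, g.fanIn ≤ 2) → f ∈ ArithCircuit.gateValues gs → complexity f ≤ gs.length := by
  intro σ f gs hfan hf
  obtain ⟨i, hi, rfl⟩ := List.getElem_of_mem hf
  have hP : (⟨gs, .gate i⟩ : ArithCircuit NNReal σ).Computes (ArithCircuit.gateValues gs)[i] := by
    simp only [ArithCircuit.Computes, ArithCircuit.eval, ArithCircuit.Operand.eval,
      List.getD_eq_getElem?_getD, List.getElem?_eq_getElem hi, Option.getD_some]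
  exact ArithCircuit.complexity_le_size (P := ⟨gs, .gate i⟩) hfan hP

end Summit.ValiantsHypothesis.ValiantsHypothesis.Theorems
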